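import Summits.QuantumFields.GaugeBoot.Certificates.SparseReducedSweep
import HarnessLib

/-!
# Sparse certificate replay, part 4d: the entry sweep walking the upper-triangular storage in lockstep

HONEST FRAMING (cell `pub-gaugeboot`): certified bounds on lattice expectations at stated coupling,
gauge group, dimension and torus size; NOT a mass gap, NOT a continuum limit, NOT a string tension;
NOT Yang–Mills-summit-bearing (barriers `FixedCouplingUltralocality`, `PerturbativeInvisibility`).

`Certificates/SparseReducedSweep.lean` computes the trace table by visiting every ordered padded entry position
`(k, i, j)`, `i, j < m`, through the symmetric accessor `Sparse.ent` (three list look-ups and one factor-row dot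
product per position).  This module visits each STORED entry once: for block `k` and row `i < m` it walks the
offset list `EB[k][i] = [e_{i,i}, e_{i,i+1}, …]` in lockstep with the factor rows `G_k[i], G_k[i+1], …`, adding
`c · ⟨G_i, G_i⟩` for the diagonal entry and `2 c · ⟨G_i, G_j⟩` for `j > i` (`sweepU`); the dot products are computed
once per stored entry.  `sweepUCheck` compares the result with the emitted table exactly as `sweepCheck` does and
proves the SAME statement `SweepOK` (`sweepOK_of_checkU`), so `objective_bound_sweep` applies unchanged.  The
combinatorial step is the symmetrisation `Σ_{i,j<m} P(i,j) = Σ_i (P(i,i) + Σ_{i<j<m} (P(i,j) + P(j,i)))` together with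
`listDot_comm`.  All `[folklore]`; nothing is claimed about lattice gauge theory.
-/

namespace Summit.QuantumFields.GaugeBoot.Certificates.Sparse

open Matrix Finset Literature.Computation.Certificates

noncomputable section

/-- The dot product of integer lists is symmetric. [folklore] -/
theorem listDot_comm : ∀ a b : List ℤ, listDot a b = listDot b a
  | [], b => by simp
  | a :: as, [] => by simp
  | a :: as, b :: bs => by rw [listDot_cons_cons, listDot_cons_cons, listDot_comm as bs, mul_comm]

/-- Row walk: offsets `t = 0, 1, …` (at most `n`) of the stored row `es` in lockstep with the factor rows `Gs`
(`= G_i, G_{i+1}, …`); weight `⟨G_i, G_{i+t}⟩`, doubled off the diagonal. [folklore] -/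
def accRowU (d lo hi : ℕ) (Gi : List ℤ) : ℕ → Bool → List (List (ℕ × ℤ)) → List (List ℤ) → Trie → Trie
  | 0, _, _, _, t => t
  | _ + 1, _, [], _, t => t
  | n + 1, first, e :: es, Gs, t =>
      accRowU d lo hi Gi n false es Gs.tail
        (accTerms d lo hi ((if first then 1 else 2) * listDot Gi (Gs.getD 0 [])) e t)

/-- Rows `i < n` of block `k` (row `i` walks at most `m - i` offsets). [folklore] -/
def accIU (GB : List (List (List ℤ))) (EB : List (List (List (List (ℕ × ℤ))))) (d lo hi m k : ℕ) :
    ℕ → Trie → Trie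
  | 0, t => t
  | i + 1, t => accIU GB EB d lo hi m k i
      (accRowU d lo hi (grow GB k i) (m - i) true ((EB.getD k []).getD i []) ((GB.getD k []).drop i) t)

/-- Blocks `k < n`. [folklore] -/
def accKU (GB : List (List (List ℤ))) (EB : List (List (List (List (ℕ × ℤ))))) (d lo hi m : ℕ) :
    ℕ → Trie → Trie
  | 0, t => t
  | k + 1, t => accKU GB EB d lo hi m k (accIU GB EB d lo hi m k m t)

/-- The lockstep sweep over `nb` blocks, variables `lo ≤ w < hi`. [folklore] -/
def sweepU (GB : List (List (List ℤ))) (EB : List (List (List (List (ℕ × ℤ))))) (nb m d lo hi : ℕ) : Trie :=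
  accKU GB EB d lo hi m nb Trie.nil

/-- The row-`i` contribution in offset form: `Σ_{t < n} μ_t · coef (EB[k][i][t]) v · ⟨G_i, G_{i+t}⟩`,
`μ_0 = 1` (resp. `2` if not `first`), `μ_t = 2`. [folklore] -/
def rowSumU (Gi : List ℤ) (v : ℕ) : ℕ → Bool → List (List (ℕ × ℤ)) → List (List ℤ) → ℤ
  | 0, _, _, _ => 0
  | _ + 1, _, [], _ => 0
  | n + 1, first, e :: es, Gs =>
      coef e v * ((if first then 1 else 2) * listDot Gi (Gs.getD 0 [])) + rowSumU Gi v n false es Gs.tail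

/-- Semantics of `accRowU`. [folklore] -/
theorem get_accRowU (d lo hi : ℕ) (hd : hi ≤ 2 ^ d) (Gi : List ℤ) (v : ℕ) (hv : v < 2 ^ d) :
    ∀ (n : ℕ) (first : Bool) (es : List (List (ℕ × ℤ))) (Gs : List (List ℤ)) (t : Trie),
      (accRowU d lo hi Gi n first es Gs t).get d v =
        t.get d v + (if lo ≤ v ∧ v < hi then rowSumU Gi v n first es Gs else 0)
  | 0, first, es, Gs, t => by simp [accRowU, rowSumU]
  | n + 1, first, [], Gs, t => by simp [accRowU, rowSumU]
  | n + 1, first, e :: es, Gs, t => by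
    rw [accRowU, get_accRowU d lo hi hd Gi v hv n false es Gs.tail, get_accTerms d lo hi hd _ v hv, rowSumU]
    by_cases hr : lo ≤ v ∧ v < hi
    · simp only [if_pos hr]; ring
    · simp [if_neg hr]

/-- `rowSumU` in indexed form: `Σ_{t < n} μ(first, t) · coef (es[t]) v · ⟨G_i, Gs[t]⟩`. [folklore] -/
theorem rowSumU_eq_sum (Gi : List ℤ) (v : ℕ) :
    ∀ (n : ℕ) (first : Bool) (es : List (List (ℕ × ℤ))) (Gs : List (List ℤ)),
      rowSumU Gi v n first es Gs =
        ∑ t ∈ Finset.range n, coef (es.getD t []) v *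
          ((if first ∧ t = 0 then 1 else 2) * listDot Gi (Gs.getD t []))
  | 0, first, es, Gs => by simp [rowSumU]
  | n + 1, first, [], Gs => by simp [rowSumU, coef]
  | n + 1, first, e :: es, Gs => by
    rw [rowSumU, rowSumU_eq_sum Gi v n false es Gs.tail, Finset.sum_range_succ', add_comm]
    congr 1
    · refine Finset.sum_congr rfl fun t _ => ?_
      have h1 : (e :: es).getD (t + 1) [] = es.getD t [] := rfl
      have h2 : Gs.getD (t + 1) [] = Gs.tail.getD t [] := by cases Gs <;> simp
      rw [h1, h2]
      simp
    · have h1 : (e :: es).getD 0 [] = e := rfl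
      rw [h1]
      cases first <;> simp

/-- The symmetrisation of a double sum over `range m × range m`. [folklore] -/
theorem sum_range_sq_symm (m : ℕ) (P : ℕ → ℕ → ℤ) :
    ∑ i ∈ Finset.range m, ∑ j ∈ Finset.range m, P i j =
      ∑ i ∈ Finset.range m, (P i i + ∑ j ∈ Finset.range m, if i < j then (P i j + P j i) else 0) := by
  have hsplit : ∀ i ∈ Finset.range m, ∑ j ∈ Finset.range m, P i j =
      (∑ j ∈ Finset.range m, if j < i then P i j else 0) + P i i +
        ∑ j ∈ Finset.range m, if i < j then P i j else 0 := by
    intro i hi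
    have h3 : ∀ j, P i j = (if j < i then P i j else 0) + (if j = i then P i j else 0) + (if i < j then P i j else 0) := by
      intro j
      rcases lt_trichotomy j i with h | h | h
      · rw [if_pos h, if_neg (ne_of_lt h), if_neg (not_lt_of_gt h)]; ring
      · subst h; rw [if_neg (lt_irrefl _), if_pos rfl]; ring
      · rw [if_neg (not_lt_of_gt h), if_neg (ne_of_gt h), if_pos h]; ring
    rw [Finset.sum_congr rfl (fun j _ => h3 j), Finset.sum_add_distrib, Finset.sum_add_distrib,
      Finset.sum_ite_eq' (Finset.range m) i (fun j => P i j), if_pos hi]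
  rw [Finset.sum_congr rfl hsplit]
  have hswap : ∑ i ∈ Finset.range m, ∑ j ∈ Finset.range m, (if j < i then P i j else 0) =
      ∑ i ∈ Finset.range m, ∑ j ∈ Finset.range m, (if i < j then P j i else 0) := Finset.sum_comm
  simp only [Finset.sum_add_distrib, hswap]
  rw [add_comm (∑ i ∈ Finset.range m, ∑ j ∈ Finset.range m, (if i < j then P j i else 0)), add_assoc,
    ← Finset.sum_add_distrib]
  congr 1
  refine Finset.sum_congr rfl fun i _ => ?_
  rw [← Finset.sum_add_distrib]
  refine Finset.sum_congr rfl fun j _ => ?_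
  split_ifs <;> ring

/-- The inner (row) sum of `posTerm` over `j < m` in offset form. [folklore] -/
theorem sum_posTerm_row (GB : List (List (List ℤ))) (EB : List (List (List (List (ℕ × ℤ))))) (v k m : ℕ) :
    ∑ i ∈ Finset.range m, ∑ j ∈ Finset.range m, posTerm GB EB v (k, i, j) =
      ∑ i ∈ Finset.range m, rowSumU (grow GB k i) v (m - i) true ((EB.getD k []).getD i []) ((GB.getD k []).drop i) := by
  rw [sum_range_sq_symm]
  refine Finset.sum_congr rfl fun i hi => ?_
  rw [Finset.mem_range] at hi
  rw [rowSumU_eq_sum]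
  set row := (EB.getD k []).getD i [] with hrow
  set Gd := (GB.getD k []).drop i with hGd
  have hG : ∀ t, Gd.getD t [] = grow GB k (i + t) := by
    intro t; simp [hGd, grow, List.getD_eq_getElem?_getD, List.getElem?_drop]
  have hent1 : ∀ t, ent EB k (i + t) i = row.getD t [] := by
    intro t; rw [ent]
    by_cases ht : i + t ≤ i
    · have : t = 0 := by omega
      subst this
      rw [if_pos ht, entU, hrow, Nat.add_zero, Nat.sub_self]
    · rw [if_neg ht, entU, hrow, Nat.add_sub_cancel_left]
  have hent2 : ∀ t, ent EB k i (i + t) = row.getD t [] := by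
    intro t; rw [ent, if_pos (Nat.le_add_right i t), entU, hrow, Nat.add_sub_cancel_left]
  have hP : ∀ a b, posTerm GB EB v (k, a, b) = coef (ent EB k b a) v * listDot (grow GB k a) (grow GB k b) :=
    fun a b => rfl
  obtain ⟨n, hn⟩ : ∃ n, m - i = n + 1 := ⟨m - i - 1, by omega⟩
  rw [hn, Finset.sum_range_succ']
  have hdiag : posTerm GB EB v (k, i, i) = coef (row.getD 0 []) v *
      ((if (true = true ∧ (0 : ℕ) = 0) then (1 : ℤ) else 2) * listDot (grow GB k i) (Gd.getD 0 [])) := by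
    rw [if_pos ⟨rfl, rfl⟩, one_mul, hG 0, Nat.add_zero, hP, ← hent2 0, Nat.add_zero]
  have hoff : ∑ j ∈ Finset.range m, (if i < j then posTerm GB EB v (k, i, j) + posTerm GB EB v (k, j, i) else 0) =
      ∑ t ∈ Finset.range n, coef (row.getD (t + 1) []) v *
        ((if (true = true ∧ t + 1 = 0) then (1 : ℤ) else 2) * listDot (grow GB k i) (Gd.getD (t + 1) [])) := by
    rw [Finset.range_eq_Ico, ← Finset.sum_Ico_consecutive _ (Nat.zero_le (i + 1)) (by omega : i + 1 ≤ m)]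
    have hz : ∑ j ∈ Finset.Ico 0 (i + 1),
        (if i < j then posTerm GB EB v (k, i, j) + posTerm GB EB v (k, j, i) else 0) = 0 :=
      Finset.sum_eq_zero fun j hj => by rw [Finset.mem_Ico] at hj; rw [if_neg (by omega)]
    rw [hz, zero_add, Finset.sum_Ico_eq_sum_range, show m - (i + 1) = n by omega]
    refine Finset.sum_congr rfl fun t _ => ?_
    rw [if_pos (by omega : i < i + 1 + t), if_neg (by simp), show i + 1 + t = i + (t + 1) by omega, hP, hP,
      hent1 (t + 1), hent2 (t + 1), hG (t + 1), listDot_comm (grow GB k (i + (t + 1))) (grow GB k i)]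
    ring
  rw [hdiag, hoff, add_comm]

/-- Semantics of `accIU`. [folklore] -/
theorem get_accIU (GB : List (List (List ℤ))) (EB : List (List (List (List (ℕ × ℤ))))) (d lo hi : ℕ)
    (hd : hi ≤ 2 ^ d) (m k v : ℕ) (hv : v < 2 ^ d) :
    ∀ (n : ℕ) (t : Trie), (accIU GB EB d lo hi m k n t).get d v =
      t.get d v + (if lo ≤ v ∧ v < hi then
        ∑ i ∈ Finset.range n, rowSumU (grow GB k i) v (m - i) true ((EB.getD k []).getD i [])
          ((GB.getD k []).drop i) else 0)
  | 0, t => by simp [accIU]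
  | n + 1, t => by
    rw [accIU, get_accIU GB EB d lo hi hd m k v hv n, get_accRowU d lo hi hd _ v hv]
    by_cases hr : lo ≤ v ∧ v < hi
    · simp only [if_pos hr, Finset.sum_range_succ]; ring
    · simp [if_neg hr]

/-- Semantics of `accKU`: the windowed position sum, as for `accK`. [folklore] -/
theorem get_accKU (GB : List (List (List ℤ))) (EB : List (List (List (List (ℕ × ℤ))))) (d lo hi : ℕ)
    (hd : hi ≤ 2 ^ d) (m v : ℕ) (hv : v < 2 ^ d) :
    ∀ (n : ℕ) (t : Trie), (accKU GB EB d lo hi m n t).get d v = t.get d v + winSum GB EB lo hi v n m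
  | 0, t => by simp [accKU, winSum]
  | n + 1, t => by
    rw [accKU, get_accKU GB EB d lo hi hd m v hv n, get_accIU GB EB d lo hi hd m n v hv]
    by_cases hr : lo ≤ v ∧ v < hi
    · simp only [winSum, if_pos hr, Finset.sum_range_succ, sum_posTerm_row]; ring
    · simp [winSum, if_neg hr]

/-- **Lockstep sweep check** for the window `lo ≤ v < hi`. [folklore] -/
def sweepUCheck (GB : List (List (List ℤ))) (EB : List (List (List (List (ℕ × ℤ))))) (nb m d : ℕ)
    (T : List ℤ) (lo hi : ℕ) : Bool :=
  decide (hi ≤ 2 ^ d) && checkT d (sweepU GB EB nb m d lo hi) (T.drop lo) lo (hi - lo)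

/-- Soundness of `sweepUCheck` (same conclusion as `sweepOK_of_check`). [folklore] -/
theorem sweepOK_of_checkU {GB : List (List (List ℤ))} {EB : List (List (List (List (ℕ × ℤ))))} {nb m d : ℕ}
    {T : List ℤ} {lo hi : ℕ} (h : sweepUCheck GB EB nb m d T lo hi = true) : SweepOK GB EB nb m T lo hi := by
  rw [sweepUCheck, Bool.and_eq_true, decide_eq_true_eq] at h
  obtain ⟨hd, hc⟩ := h
  intro v hlo hhi
  have hv : v < 2 ^ d := lt_of_lt_of_le hhi hd
  have hget := checkT_sound d _ T (hi - lo) lo hc v hlo (by omega)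
  rw [sweepU, get_accKU GB EB d lo hi hd m v hv, winSum, if_pos ⟨hlo, hhi⟩] at hget
  simp only [Trie.get, zero_add] at hget
  rw [← hget, ← Fin.sum_univ_eq_sum_range]
  refine Finset.sum_congr rfl fun k _ => ?_
  rw [← Fin.sum_univ_eq_sum_range]
  refine Finset.sum_congr rfl fun i _ => ?_
  rw [← Fin.sum_univ_eq_sum_range]

end

end Summit.QuantumFields.GaugeBoot.Certificates.Sparse
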